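import Summits.CriticalPhenomena.PercolationContinuityZ3.Theses.PercNonProliferation
import Summits.CriticalPhenomena.PercolationContinuityZ3.Theorems.NonProliferation.Negative.AboveSix
import Literature.Barriers.CriticalPhenomena.SpanningClustersAboveSix
import Literature.Probability.Percolation.RussoFormula
import HarnessLib

/-!
# Crux `PercNonProliferation.NonProliferation` (stmt-CriticalPhenomena-4444), line `birth-merge-ledger` — stub `stub_signedRusso`

Helper file for the lead's skeleton of line `birth-merge-ledger`
(`Cruxes/NonProliferation/Lines/birth_merge_ledger.lean`, prover-line-stmt-CriticalPhenomena-4444-0).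
Proves exactly the registered stub signature `stub_signedRusso`; lands with `--supports stmt-CriticalPhenomena-4444`.

## Content

The signed (Margulis–)Russo formula for an ARBITRARY cylinder event (no monotonicity):
for an event `A` determined by a finite set `K` of pairs and `p ∈ (0, 1)`,

`d/dp P_p(A) = Σ_{e ∈ K} ( P_p{ω | e ∈ E(G), ω ∪ {e} ∈ A} - P_p{ω | e ∈ E(G), ω \ {e} ∈ A} )`

(Grimmett, *Percolation* (1999), Thm. 2.32; Russo (1981), §4, proof of Lemma 3, where
`∂/∂x_i μ_x(A) = μ_x(A ∘ (· ∪ {i})) - μ_x(A ∘ (· \ {i}))` before positivity is used).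

The argument is the one of `Literature.Probability.Percolation.russo_formula_sum_holds`
(`RussoFormula.lean`): on `(0, 1)` the map `q ↦ P_q(A)` is the polynomial
`Russo.cylPoly E(G) K A` (`Russo.measureReal_eq_cylPoly`), differentiated by
`Russo.hasDerivAt_cylPoly`. The only new ingredient is
`StubSignedRusso.sum_dweight_eq_measureReal_insert_sub`, the signed replacement of
`Russo.sum_dweight_eq_measureReal_pivotal`: pairing the cylinders `S ↔ S ∪ {e}` turns the
`e`-th term of the derivative into `Σ_{S ⊆ K \ {e}} (∏_{i ≠ e} weight) (1[S ∪ {e} ∈ A] - 1[S ∈ A])`,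
and the two sums are the probabilities of the events `{ω | ω ∪ {e} ∈ A}`, `{ω | ω \ {e} ∈ A}`,
both determined by `K \ {e}` (`StubSignedRusso.determinedBy_insert_mem`,
`StubSignedRusso.determinedBy_sdiff_mem`). The graph-general statement is
`StubSignedRusso.hasDerivAt_real_signed`; the stub is its specialisation to `zdGraph d`.
-/

noncomputable section

namespace Summit.CriticalPhenomena.PercolationContinuityZ3.Theorems.NonProliferation

open MeasureTheory Filter Topology
open Literature.Probability.LatticeModels Literature.Probability.Percolation
open Literature.Barriers.CriticalPhenomena
open Summit.CriticalPhenomena.PercolationContinuityZ3.Theorems.NonProliferation.Negative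

namespace StubSignedRusso

open ProbabilityTheory unitInterval
open scoped ProbabilityTheory ENNReal

variable {ι : Type*}

/-- If `A` is determined by `K`, then the event "`A` holds after opening `e`",
`{ω | insert e ω ∈ A}`, is determined by `K \ {e}` (Russo 1981, §4, proof of Lemma 3). -/
theorem determinedBy_insert_mem {A : Set (Set ι)} {K : Finset ι} [DecidableEq ι]
    (hA : DeterminedBy A (↑K : Set ι)) (e : ι) :
    DeterminedBy {ω | insert e ω ∈ A} (↑(K.erase e) : Set ι) := by
  rw [determinedBy_iff] at hA ⊢
  intro ω ω' h
  have hi : ∀ i ∈ K, i ≠ e → (i ∈ ω ↔ i ∈ ω') := by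
    intro i hiK hie
    have := Set.ext_iff.1 h i
    simp only [Set.mem_inter_iff, Finset.coe_erase, Set.mem_sdiff, Finset.mem_coe,
      Set.mem_singleton_iff] at this
    tauto
  refine hA _ _ ?_
  ext i
  simp only [Set.mem_inter_iff, Set.mem_insert_iff, Finset.mem_coe]
  by_cases hie : i = e
  · simp [hie]
  · have := fun hiK => hi i hiK hie
    tauto

/-- If `A` is determined by `K`, then the event "`A` holds after closing `e`",
`{ω | ω \ {e} ∈ A}`, is determined by `K \ {e}` (Russo 1981, §4, proof of Lemma 3). -/
theorem determinedBy_sdiff_mem {A : Set (Set ι)} {K : Finset ι} [DecidableEq ι]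
    (hA : DeterminedBy A (↑K : Set ι)) (e : ι) :
    DeterminedBy {ω | ω \ {e} ∈ A} (↑(K.erase e) : Set ι) := by
  rw [determinedBy_iff] at hA ⊢
  intro ω ω' h
  have h1 : ∀ ω : Set ι, (ω \ {e}) ∩ (↑K : Set ι) = ω ∩ ↑(K.erase e) := by
    intro ω; ext i
    simp only [Set.mem_inter_iff, Set.mem_sdiff, Set.mem_singleton_iff, Finset.coe_erase,
      Finset.mem_coe]
    tauto
  refine hA _ _ ?_
  rw [h1, h1, h]

open Classical in
/-- The pairing `S ↔ insert e S` for an ARBITRARY event `A` determined by `K` and `e ∈ K`: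
the `e`-th partial derivative of `Russo.cylPoly` is
`P(ω ∪ {e} ∈ A) - P(ω \ {e} ∈ A)` restricted to `e ∈ u` (coordinates outside `u` are a.s.
closed with `q`-independent weight and contribute `0`). Signed form of
`Russo.sum_dweight_eq_measureReal_pivotal` (Russo 1981, §4, proof of Lemma 3;
Grimmett 1999, Thm. 2.32). -/
theorem sum_dweight_eq_measureReal_insert_sub [DecidableEq ι] {A : Set (Set ι)}
    {K : Finset ι} (hK : DeterminedBy A (↑K : Set ι)) (u : Set ι) (p : unitInterval) {e : ι}
    (he : e ∈ K) :
    (∑ S ∈ K.powerset, if (↑S : Set ι) ∈ A then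
        (∏ j ∈ K.erase e, Russo.weight u ↑S j p) * Russo.dweight u ↑S e else 0) =
      (setBer(u, p)).real {ω | e ∈ u ∧ insert e ω ∈ A} -
        (setBer(u, p)).real {ω | e ∈ u ∧ ω \ {e} ∈ A} := by
  classical
  by_cases heu : e ∈ u
  swap
  · have h0 : ∀ S : Finset ι, Russo.dweight u (↑S : Set ι) e = 0 := by
      intro S; unfold Russo.dweight; simp [heu]
    simp [h0, heu]
  have hev₁ : {ω | e ∈ u ∧ insert e ω ∈ A} = {ω | insert e ω ∈ A} := by
    ext ω; simp [heu]
  have hev₂ : {ω : Set ι | e ∈ u ∧ ω \ {e} ∈ A} = {ω | ω \ {e} ∈ A} := by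
    ext ω; simp [heu]
  rw [hev₁, hev₂, Russo.measureReal_eq_cylPoly (determinedBy_insert_mem hK e) u p,
    Russo.measureReal_eq_cylPoly (determinedBy_sdiff_mem hK e) u p]
  simp only [Russo.cylPoly]
  have hpow : K.powerset = (K.erase e).powerset ∪ (K.erase e).powerset.image (insert e) := by
    rw [← Finset.powerset_insert, Finset.insert_erase he]
  have hdisj : Disjoint (K.erase e).powerset ((K.erase e).powerset.image (insert e)) := by
    rw [Finset.disjoint_left]
    intro S hS hS'
    obtain ⟨T, -, rfl⟩ := Finset.mem_image.1 hS'
    have := Finset.mem_powerset.1 hS (Finset.mem_insert_self e T)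
    simp at this
  have hinj : Set.InjOn (insert e) (↑(K.erase e).powerset : Set (Finset ι)) := by
    intro S hS T hT hST
    have heS : e ∉ S := fun h => by simpa using Finset.mem_powerset.1 hS h
    have heT : e ∉ T := fun h => by simpa using Finset.mem_powerset.1 hT h
    rw [← Finset.erase_insert heS, ← Finset.erase_insert heT, hST]
  rw [hpow, Finset.sum_union hdisj, Finset.sum_image hinj, ← Finset.sum_add_distrib,
    ← Finset.sum_sub_distrib]
  refine Finset.sum_congr rfl fun S hS => ?_
  have heS : e ∉ S := fun h => by simpa using Finset.mem_powerset.1 hS h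
  have heS' : e ∉ (↑S : Set ι) := by simpa using heS
  have hdS : Russo.dweight u (↑S : Set ι) e = -1 := by simp [Russo.dweight, heS', heu]
  have hdiS : Russo.dweight u (↑(insert e S) : Set ι) e = 1 := by simp [Russo.dweight, heu]
  have hwi : ∏ j ∈ K.erase e, Russo.weight u (↑(insert e S) : Set ι) j p =
      ∏ j ∈ K.erase e, Russo.weight u (↑S : Set ι) j p := by
    refine Finset.prod_congr rfl fun j hj => ?_
    rw [Finset.coe_insert]
    exact Russo.weight_insert_of_ne u _ (Finset.ne_of_mem_erase hj) _
  rw [hdS, hdiS, hwi, Set.mem_setOf_eq, Set.mem_setOf_eq, Set.sdiff_singleton_eq_self heS',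
    Finset.coe_insert]
  by_cases hSA : (↑S : Set ι) ∈ A <;> by_cases hiA : insert e (↑S : Set ι) ∈ A <;>
    simp [hSA, hiA]

variable {V : Type*}

/-- **Signed Russo formula** (Grimmett, *Percolation* (1999), Thm. 2.32; Russo (1981), §4):
for an arbitrary (not necessarily increasing) event `A` determined by the finite set `K` of
pairs and `p ∈ (0, 1)`,
`d/dp P_p(A) = Σ_{e ∈ K} (P_p{e ∈ E(G), ω ∪ {e} ∈ A} - P_p{e ∈ E(G), ω \ {e} ∈ A})`.
Proof as for `russo_formula_sum_holds`: `P_q(A)` is the polynomial `Russo.cylPoly E(G) K A q`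
on `(0, 1)`; differentiate and pair cylinders `S ↔ S ∪ {e}`
(`sum_dweight_eq_measureReal_insert_sub`). -/
theorem hasDerivAt_real_signed (G : SimpleGraph V) {A : Set (BondConfig V)}
    (K : Finset (Sym2 V)) (hK : DeterminedBy A (↑K : Set (Sym2 V))) (p : ℝ)
    (hp : p ∈ Set.Ioo (0 : ℝ) 1) :
    HasDerivAt (fun q : ℝ => (bondPercolation G (Set.projIcc 0 1 zero_le_one q)).real A)
      (∑ e ∈ K, ((bondPercolation G (Set.projIcc 0 1 zero_le_one p)).real
          {ω | e ∈ G.edgeSet ∧ insert e ω ∈ A} -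
        (bondPercolation G (Set.projIcc 0 1 zero_le_one p)).real
          {ω | e ∈ G.edgeSet ∧ ω \ {e} ∈ A})) p := by
  classical
  have hpI : p ∈ Set.Icc (0 : ℝ) 1 := ⟨hp.1.le, hp.2.le⟩
  have heq : Russo.cylPoly G.edgeSet K A =ᶠ[nhds p]
      (fun q : ℝ => (bondPercolation G (Set.projIcc 0 1 zero_le_one q)).real A) := by
    filter_upwards [Ioo_mem_nhds hp.1 hp.2] with q hq
    rw [Set.projIcc_of_mem _ ⟨hq.1.le, hq.2.le⟩, bondPercolation]
    exact (Russo.measureReal_eq_cylPoly hK G.edgeSet ⟨q, hq.1.le, hq.2.le⟩).symm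
  refine ((Russo.hasDerivAt_cylPoly G.edgeSet K A p).congr_deriv ?_).congr_of_eventuallyEq
    heq.symm
  rw [Set.projIcc_of_mem _ hpI]
  refine Finset.sum_congr rfl fun e he => ?_
  rw [bondPercolation]
  exact sum_dweight_eq_measureReal_insert_sub hK G.edgeSet ⟨p, hpI⟩ he

end StubSignedRusso

/-- **Stub `stub_signedRusso`** of line `birth-merge-ledger` (crux stmt-CriticalPhenomena-4444):
the signed (Margulis–)Russo formula on `ℤ^d` for an arbitrary cylinder event `A` determined by
the finite edge set `K` (Grimmett, *Percolation* (1999), Thm. 2.32): for `t ∈ (0, 1)`,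
`d/dt P_t(A) = Σ_{e ∈ K} (P_t{e ∈ E(ℤ^d), ω ∪ {e} ∈ A} - P_t{e ∈ E(ℤ^d), ω \ {e} ∈ A})`,
the parameter being extended constantly outside `[0, 1]` via `Set.projIcc`. Specialisation of
`StubSignedRusso.hasDerivAt_real_signed` to `G = zdGraph d`. -/
theorem stub_signedRusso :
    ∀ (d : ℕ) (A : Set (BondConfig (Site d))) (K : Finset (Sym2 (Site d))), DeterminedBy A (↑K : Set (Sym2 (Site d))) → ∀ t ∈ Set.Ioo (0 : ℝ) 1, HasDerivAt (fun s : ℝ => (bondPercolation (zdGraph d) (Set.projIcc (0 : ℝ) 1 zero_le_one s)).real A) (∑ e ∈ K, ((bondPercolation (zdGraph d) (Set.projIcc (0 : ℝ) 1 zero_le_one t)).real {ω | e ∈ (zdGraph d).edgeSet ∧ insert e ω ∈ A} - (bondPercolation (zdGraph d) (Set.projIcc (0 : ℝ) 1 zero_le_one t)).real {ω | e ∈ (zdGraph d).edgeSet ∧ ω \ {e} ∈ A})) t := by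
  intro d A K hK t ht
  exact StubSignedRusso.hasDerivAt_real_signed (zdGraph d) K hK t ht

end Summit.CriticalPhenomena.PercolationContinuityZ3.Theorems.NonProliferation

end
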